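import Summits.AtomisticToContinuum.HydrodynamicLimit.Theorems.EnskogAdjointDualityAdjointEnskogTestFamilyRCorrectorPointwise
import Summits.AtomisticToContinuum.HydrodynamicLimit.Theorems.EnskogAdjointDualityAdjointEnskogTestFamilyRCorrectorPosition
import HarnessLib

/-!
# K2R corrector balance III: the slice estimate (local detailed balance + coupling)

Route `EnskogAdjointDuality` of `AtomisticToContinuum/HydrodynamicLimit`, crux `AdjointEnskogTestFamilyR`
(stmt-AtomisticToContinuum-11592, "K2R"), line `birth`, stub `stub_correctorBalance` (B4): the corrector `κ` of
the test family `φ^N = ψ^N + κ^N/λ_N` pairs to `O(ε)` with the test-side Enskog operator against the Euler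
local Maxwellian `f = ρ₀ M_{1,θ₀,u₀}` (local detailed balance: the `λ_N` of the operator cancels the `1/λ_N`
of the corrector, and the equal-position bracket integrates to zero).
This file proves the heart of the estimate, for a fixed pair of positions and a fixed impact direction:

* `k2r_bracket_coupled` — the pointwise bracket estimate of file I at Gaussian-coupled partner velocities;
* `k2r_integrable_twoMaxwellian_kernel_mul`, `k2r_integrable_twoMaxwellian_row` — domination of
  `M_{θ,u}(v) M_{θ′,u′}(w) ((v−w)·ω)₊ W(v,w)` on `ℝ³ × ℝ³` (two different Maxwellians) and of its rows;
* `k2r_oneMaxwellian_bracket_rows_eq_zero` — local detailed balance: the one-Maxwellian, one-function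
  bracket integrates to zero (the bracket identity `integral_localMaxwellian_kernel_bracket`);
* `k2r_slice_inner`, `k2r_corrector_slice` —
  `|∫ M_{θ,u}(v) ∫ ((v−w)·ω)₊ M_{θ′,u′}(w) [κ₁(v′) + κ₂(w′) − κ₁(v) − κ₂(w)] dw dv| ≤ K C (d + |θ − θ′| + ‖u − u′‖)`;
* `stub_correctorBalance_slice` — the registered sub-goal (closed form of `k2r_corrector_slice`).

References: C. Cercignani, R. Illner, M. Pulvirenti, *The Mathematical Theory of Dilute Gases* (1994), §3.1
(collision kinematics, detailed balance) [CIP1994].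
-/

noncomputable section

open MeasureTheory ProbabilityTheory Metric Set Filter Topology Function
open scoped InnerProductSpace ENNReal

namespace Summit.AtomisticToContinuum.HydrodynamicLimit.Theorems.EnskogAdjointDuality

open Literature.Analysis.FluidPDE Literature.MathematicalPhysics.KineticTheory

/-! ## The coupled pointwise estimate and two-Maxwellian domination -/

/-- **Pointwise bracket estimate at Gaussian-coupled partner velocities.** With the hypotheses of
`k2r_bracket_pointwise`, parameters `θ, θ′ ∈ [θm, Θ]`, `‖u‖, ‖u′‖ ≤ U` and the coupling
`a = u′ + √θ′ z`, `b = u + √θ z` of `M_{1,θ′,u′}` with `M_{1,θ,u}`: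
`|bracket₂(v, a) − bracket₁(v, b)| ≤ 16 (1+2U²+2Θ)⁴ (1 + (2√θm)⁻¹) · C (1+|v|²)² (1+|z|²)⁵ (d + |θ−θ′| + ‖u−u′‖)`.
[folklore] -/
theorem k2r_bracket_coupled {θm Θ U θ θ' : ℝ} {u u' : V3} (hθm : 0 < θm) (hθ : θm ≤ θ) (hθΘ : θ ≤ Θ)
    (hθ' : θm ≤ θ') (hθ'Θ : θ' ≤ Θ) (hu : ‖u‖ ≤ U) (hu' : ‖u'‖ ≤ U) (ω : sphere (0 : V3) 1)
    {κ₁ κ₂ : V3 → ℝ} {C d : ℝ} (hd : 0 ≤ d) (hκ₁ : ∀ v, |κ₁ v| ≤ C * (1 + ‖v‖ ^ 2))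
    (hκ₁L : ∀ v v', |κ₁ v - κ₁ v'| ≤ C * (1 + ‖v‖ ^ 2 + ‖v'‖ ^ 2) * ‖v - v'‖)
    (hκ₁₂ : ∀ v, |κ₁ v - κ₂ v| ≤ C * (1 + ‖v‖ ^ 2 + ‖v‖ ^ 2) * d) (v z : V3) :
    |hardSphereKernel (v, u' + Real.sqrt θ' • z) ω *
        (κ₁ (collide ω (v, u' + Real.sqrt θ' • z)).1 + κ₂ (collide ω (v, u' + Real.sqrt θ' • z)).2 -
          κ₁ v - κ₂ (u' + Real.sqrt θ' • z)) -
      hardSphereKernel (v, u + Real.sqrt θ • z) ω *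
        (κ₁ (collide ω (v, u + Real.sqrt θ • z)).1 + κ₁ (collide ω (v, u + Real.sqrt θ • z)).2 -
          κ₁ v - κ₁ (u + Real.sqrt θ • z))| ≤
      16 * (1 + 2 * U ^ 2 + 2 * Θ) ^ 4 * (1 + (2 * Real.sqrt θm)⁻¹) * C * (1 + ‖v‖ ^ 2) ^ 2 *
        (1 + ‖z‖ ^ 2) ^ 5 * (d + |θ - θ'| + ‖u - u'‖) := by
  have hC : 0 ≤ C := by
    have h := (abs_nonneg _).trans (hκ₁ 0)
    simpa using h
  set a : V3 := u' + Real.sqrt θ' • z with ha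
  set b : V3 := u + Real.sqrt θ • z with hb
  have h := k2r_bracket_pointwise ω hd hκ₁ hκ₁L hκ₁₂ v a b
  set c₁ : ℝ := 1 + 2 * U ^ 2 + 2 * Θ with hc₁
  set L : ℝ := 1 + (2 * Real.sqrt θm)⁻¹ with hL
  set W : ℝ := 1 + ‖z‖ ^ 2 with hW
  set X : ℝ := 1 + ‖v‖ ^ 2 with hX
  have hYa : 1 + ‖a‖ ^ 2 ≤ c₁ * W := k2r_coupling_norm_sq_le hu' (hθm.le.trans hθ') hθ'Θ z
  have hZb : 1 + ‖b‖ ^ 2 ≤ c₁ * W := k2r_coupling_norm_sq_le hu (hθm.le.trans hθ) hθΘ z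
  have hδ : d + ‖a - b‖ ≤ L * W * (d + |θ - θ'| + ‖u - u'‖) := k2r_coupling_sub_le hθm hθ hθ' u u' z hd
  clear_value a b c₁ L W X
  have hX0 : 0 ≤ X := by rw [hX]; positivity
  have hP0 : 0 ≤ X * (1 + ‖a‖ ^ 2) * (1 + ‖b‖ ^ 2) := by positivity
  have hP : X * (1 + ‖a‖ ^ 2) * (1 + ‖b‖ ^ 2) ≤ X * (c₁ * W) * (c₁ * W) :=
    mul_le_mul (mul_le_mul_of_nonneg_left hYa hX0) hZb (by positivity) (mul_nonneg hX0 ((by positivity : (0:ℝ) ≤ 1 + ‖a‖ ^ 2).trans hYa))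
  have hP2 : (X * (1 + ‖a‖ ^ 2) * (1 + ‖b‖ ^ 2)) ^ 2 ≤ (X * (c₁ * W) * (c₁ * W)) ^ 2 :=
    pow_le_pow_left₀ hP0 hP 2
  have hd0 : 0 ≤ d + ‖a - b‖ := add_nonneg hd (norm_nonneg _)
  refine h.trans ?_
  calc 16 * C * (X * (1 + ‖a‖ ^ 2) * (1 + ‖b‖ ^ 2)) ^ 2 * (d + ‖a - b‖)
      ≤ 16 * C * (X * (c₁ * W) * (c₁ * W)) ^ 2 * (L * W * (d + |θ - θ'| + ‖u - u'‖)) :=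
        mul_le_mul (mul_le_mul_of_nonneg_left hP2 (by positivity)) hδ hd0 (by positivity)
    _ = 16 * c₁ ^ 4 * L * C * X ^ 2 * W ^ 5 * (d + |θ - θ'| + ‖u - u'‖) := by ring

/-- **Domination of the two-Maxwellian two-velocity integrands.** For `θ, θ′ > 0`, a fixed direction `ω`
and an a.e.-strongly measurable weight `|W(v, w)| ≤ C ((1 + ‖v‖)(1 + ‖w‖))ᵐ`, the integrand
`M_{1,θ,u}(v) M_{1,θ′,u′}(w) ((v−w)·ω)₊ W(v, w)` is integrable on `ℝ³ × ℝ³`. [folklore] -/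
theorem k2r_integrable_twoMaxwellian_kernel_mul {θ θ' : ℝ} (hθ : 0 < θ) (hθ' : 0 < θ') (u u' : V3)
    (ω : sphere (0 : V3) 1) {W : V3 × V3 → ℝ} (hWm : AEStronglyMeasurable W ((volume : Measure V3).prod volume))
    {C : ℝ} {m : ℕ} (hW : ∀ p, |W p| ≤ C * ((1 + ‖p.1‖) * (1 + ‖p.2‖)) ^ m) :
    Integrable (fun p : V3 × V3 => localMaxwellian 1 θ u p.1 * localMaxwellian 1 θ' u' p.2 *
        hardSphereKernel p ω * W p) ((volume : Measure V3).prod volume) := by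
  -- adapted from `integrable_localMaxwellian_kernel_mul` (one Maxwellian) in the KernelSymmetry file
  set ρ : V3 → ℝ := fun v => (1 + ‖v‖) ^ (m + 1) * localMaxwellian 1 θ u v with hρ
  set ρ' : V3 → ℝ := fun v => (1 + ‖v‖) ^ (m + 1) * localMaxwellian 1 θ' u' v with hρ'
  have hρi : Integrable ρ := integrable_one_add_norm_pow_mul_localMaxwellian hθ u (m + 1)
  have hρ'i : Integrable ρ' := integrable_one_add_norm_pow_mul_localMaxwellian hθ' u' (m + 1)
  have hdom : Integrable (fun p : V3 × V3 => |C| * (ρ p.1 * ρ' p.2)) ((volume : Measure V3).prod volume) :=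
    (hρi.mul_prod hρ'i).const_mul _
  refine hdom.mono' ?_ (Eventually.of_forall fun p => ?_)
  · have hM : Continuous fun p : V3 × V3 =>
        localMaxwellian 1 θ u p.1 * localMaxwellian 1 θ' u' p.2 * hardSphereKernel p ω := by
      unfold hardSphereKernel
      have h1 := continuous_localMaxwellian 1 θ u
      have h2 := continuous_localMaxwellian 1 θ' u'
      fun_prop
    exact hM.aestronglyMeasurable.mul hWm
  obtain ⟨v, w⟩ := p
  have hMv := localMaxwellian_nonneg zero_le_one hθ.le u v
  have hMw := localMaxwellian_nonneg zero_le_one hθ'.le u' w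
  have hK0 := UkaiLanford.hardSphereKernel_nonneg' (v, w) ω
  have hK := UkaiLanford.hardSphereKernel_le_weight (v, w) ω
  rw [Real.norm_eq_abs, abs_mul, abs_mul, abs_mul, abs_of_nonneg hMv, abs_of_nonneg hMw,
    abs_of_nonneg hK0]
  set X : ℝ := (1 + ‖v‖) * (1 + ‖w‖) with hX
  have hWX : |W (v, w)| ≤ |C| * X ^ m :=
    (hW (v, w)).trans (mul_le_mul_of_nonneg_right (le_abs_self _) (by positivity))
  have hρvw : ρ v * ρ' w = X ^ (m + 1) * (localMaxwellian 1 θ u v * localMaxwellian 1 θ' u' w) := by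
    simp only [hρ, hρ', hX, mul_pow]
    ring
  calc localMaxwellian 1 θ u v * localMaxwellian 1 θ' u' w * hardSphereKernel (v, w) ω * |W (v, w)|
      ≤ localMaxwellian 1 θ u v * localMaxwellian 1 θ' u' w * X * (|C| * X ^ m) :=
        mul_le_mul (mul_le_mul_of_nonneg_left hK (mul_nonneg hMv hMw)) hWX (abs_nonneg _)
          (by positivity)
    _ = |C| * (ρ v * ρ' w) := by rw [hρvw]; ring

/-! ## The slice estimate: fixed position pair and impact direction -/

/-- Integrability of the Maxwellian-weighted rows with two different local Maxwellians:
`v ↦ M_{θ,u}(v) ∫ M_{θ′,u′}(w) ((v−w)·ω)₊ W(v, w) dw` is integrable for a continuous weight of polynomial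
growth (Fubini, from `k2r_integrable_twoMaxwellian_kernel_mul`). [folklore] -/
theorem k2r_integrable_twoMaxwellian_row {θ θ' : ℝ} (hθ : 0 < θ) (hθ' : 0 < θ') (u u' : V3)
    (ω : sphere (0 : V3) 1) {W : V3 × V3 → ℝ} (hWc : Continuous W) {C : ℝ} {m : ℕ}
    (hW : ∀ p, |W p| ≤ C * ((1 + ‖p.1‖) * (1 + ‖p.2‖)) ^ m) :
    Integrable (fun v : V3 => localMaxwellian 1 θ u v *
      ∫ w, localMaxwellian 1 θ' u' w * (hardSphereKernel (v, w) ω * W (v, w))) := by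
  have hF := k2r_integrable_twoMaxwellian_kernel_mul hθ hθ' u u' ω hWc.aestronglyMeasurable hW
  refine hF.integral_prod_left.congr (Eventually.of_forall fun v => ?_)
  simp only
  rw [← integral_const_mul]
  refine integral_congr_ae (Eventually.of_forall fun w => ?_)
  ring

/-- **Local detailed balance.** For ONE local Maxwellian and ONE continuous velocity function `κ₁` of
quadratic growth, the Maxwellian-weighted collision bracket integrates to zero:
`∫ M(v) ∫ M(w) ((v−w)·ω)₊ [κ₁(v′) + κ₁(w′) − κ₁(v) − κ₁(w)] dw dv = 0` (the bracket identity
`integral_localMaxwellian_kernel_bracket` with `ψ₁ = ψ₂`, read as an iterated integral). [cite: CIP1994, §3.1] -/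
theorem k2r_oneMaxwellian_bracket_rows_eq_zero {θ : ℝ} (hθ : 0 < θ) (u : V3) (ω : sphere (0 : V3) 1)
    {κ₁ : V3 → ℝ} (hκ₁c : Continuous κ₁) {C : ℝ} (hκ₁ : ∀ v, |κ₁ v| ≤ C * (1 + ‖v‖ ^ 2)) :
    ∫ v, localMaxwellian 1 θ u v * ∫ w, localMaxwellian 1 θ u w * (hardSphereKernel (v, w) ω *
        (κ₁ (collide ω (v, w)).1 + κ₁ (collide ω (v, w)).2 - κ₁ v - κ₁ w)) = 0 := by
  have hB := integral_localMaxwellian_kernel_bracket hθ u ω hκ₁c hκ₁c hκ₁ hκ₁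
  rw [sub_self] at hB
  set F : V3 × V3 → ℝ := fun p => localMaxwellian 1 θ u p.1 * localMaxwellian 1 θ u p.2 *
    hardSphereKernel p ω * (κ₁ (collide ω p).1 + κ₁ (collide ω p).2 - κ₁ p.1 - κ₁ p.2) with hF
  have hFi : Integrable F ((volume : Measure V3).prod volume) := by
    obtain ⟨h1, h2, h3, h4⟩ := integrable_localMaxwellian_kernel_quad hθ u ω hκ₁c hκ₁
    refine (((h3.add h4).sub h1).sub h2).congr (Eventually.of_forall fun p => ?_)
    simp only [hF, Pi.add_apply, Pi.sub_apply]
    ring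
  have hrow : ∀ v : V3, localMaxwellian 1 θ u v * ∫ w, localMaxwellian 1 θ u w * (hardSphereKernel (v, w) ω *
      (κ₁ (collide ω (v, w)).1 + κ₁ (collide ω (v, w)).2 - κ₁ v - κ₁ w)) = ∫ w, F (v, w) := by
    intro v
    rw [← integral_const_mul]
    refine integral_congr_ae (Eventually.of_forall fun w => ?_)
    simp only [hF]
    ring
  rw [integral_congr_ae (Eventually.of_forall hrow), ← integral_prod F hFi]
  exact hB

/-- **The inner coupling estimate.** For fixed `v`, parameters `θ, θ′ ∈ [θm, Θ]`, `‖u‖, ‖u′‖ ≤ U`, and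
velocity functions as in `k2r_bracket_coupled`, the `w`-integrals of the two-function bracket against
`M_{1,θ′,u′}` and of the one-function bracket against `M_{1,θ,u}` differ by at most
`16 (1+2U²+2Θ)⁴ (1 + (2√θm)⁻¹) C (1+|v|²)² (d + |θ−θ′| + ‖u−u′‖) ∫ (1+|z|²)⁵ dγ(z)`: both integrals are
integrals against the standard Gaussian `γ` after the coupling `w = u′ + √θ′ z`, resp. `w = u + √θ z`
(`integral_localMaxwellian_smul`), and the integrands are compared pointwise. [folklore] -/
theorem k2r_slice_inner {θm Θ U θ θ' : ℝ} {u u' : V3} (hθm : 0 < θm) (hθ : θm ≤ θ) (hθΘ : θ ≤ Θ)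
    (hθ' : θm ≤ θ') (hθ'Θ : θ' ≤ Θ) (hu : ‖u‖ ≤ U) (hu' : ‖u'‖ ≤ U) (ω : sphere (0 : V3) 1)
    {κ₁ κ₂ : V3 → ℝ} (hκ₁c : Continuous κ₁) (hκ₂c : Continuous κ₂) {C d : ℝ} (hd : 0 ≤ d)
    (hκ₁ : ∀ v, |κ₁ v| ≤ C * (1 + ‖v‖ ^ 2)) (hκ₂ : ∀ v, |κ₂ v| ≤ C * (1 + ‖v‖ ^ 2))
    (hκ₁L : ∀ v v', |κ₁ v - κ₁ v'| ≤ C * (1 + ‖v‖ ^ 2 + ‖v'‖ ^ 2) * ‖v - v'‖)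
    (hκ₁₂ : ∀ v, |κ₁ v - κ₂ v| ≤ C * (1 + ‖v‖ ^ 2 + ‖v‖ ^ 2) * d) (v : V3) :
    |(∫ w, localMaxwellian 1 θ' u' w * (hardSphereKernel (v, w) ω *
        (κ₁ (collide ω (v, w)).1 + κ₂ (collide ω (v, w)).2 - κ₁ v - κ₂ w))) -
      ∫ w, localMaxwellian 1 θ u w * (hardSphereKernel (v, w) ω *
        (κ₁ (collide ω (v, w)).1 + κ₁ (collide ω (v, w)).2 - κ₁ v - κ₁ w))| ≤
      16 * (1 + 2 * U ^ 2 + 2 * Θ) ^ 4 * (1 + (2 * Real.sqrt θm)⁻¹) * C * (1 + ‖v‖ ^ 2) ^ 2 *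
        (d + |θ - θ'| + ‖u - u'‖) * ∫ z, (1 + ‖z‖ ^ 2) ^ 5 ∂stdGaussian V3 := by
  have hθ0 : 0 < θ := hθm.trans_le hθ
  have hθ'0 : 0 < θ' := hθm.trans_le hθ'
  set A : V3 → ℝ := fun w => hardSphereKernel (v, w) ω *
    (κ₁ (collide ω (v, w)).1 + κ₂ (collide ω (v, w)).2 - κ₁ v - κ₂ w) with hA
  set A₀ : V3 → ℝ := fun w => hardSphereKernel (v, w) ω *
    (κ₁ (collide ω (v, w)).1 + κ₁ (collide ω (v, w)).2 - κ₁ v - κ₁ w) with hA₀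
  have e1 : ∫ w, localMaxwellian 1 θ' u' w * A w = ∫ z, A (u' + Real.sqrt θ' • z) ∂stdGaussian V3 :=
    integral_localMaxwellian_smul hθ'0 u' A
  have e2 : ∫ w, localMaxwellian 1 θ u w * A₀ w = ∫ z, A₀ (u + Real.sqrt θ • z) ∂stdGaussian V3 :=
    integral_localMaxwellian_smul hθ0 u A₀
  rw [e1, e2]
  -- integrability of the two coupled integrands under the standard Gaussian
  have hAc : Continuous A := by
    simp only [hA, hardSphereKernel]
    fun_prop
  have hA₀c : Continuous A₀ := by
    simp only [hA₀, hardSphereKernel]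
    fun_prop
  have hAb : ∀ w, |A w| ≤ 4 * C * (1 + ‖v‖ ^ 2) ^ 2 * (1 + ‖w‖ ^ 2) ^ 2 := fun w =>
    (k2r_abs_bracket_le ω hκ₁ hκ₂ v w).trans (le_of_eq (by ring))
  have hA₀b : ∀ w, |A₀ w| ≤ 4 * C * (1 + ‖v‖ ^ 2) ^ 2 * (1 + ‖w‖ ^ 2) ^ 2 := fun w =>
    (k2r_abs_bracket_le ω hκ₁ hκ₁ v w).trans (le_of_eq (by ring))
  have hi1 : Integrable (fun z : V3 => A (u' + Real.sqrt θ' • z)) (stdGaussian V3) :=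
    k2r_integrable_comp_coupling hAc hAb u' hθ'0.le
  have hi2 : Integrable (fun z : V3 => A₀ (u + Real.sqrt θ • z)) (stdGaussian V3) :=
    k2r_integrable_comp_coupling hA₀c hA₀b u hθ0.le
  rw [← integral_sub hi1 hi2]
  -- pointwise bound (`k2r_bracket_coupled`) and integration
  have hG : Integrable (fun z : V3 => (1 + ‖z‖ ^ 2) ^ 5) (stdGaussian V3) := by
    rw [← CorrectorPressureDecayNegative.gaussMeasure_zero_one]
    exact integrable_one_add_norm_sq_pow_gaussMeasure 0 1 5
  have hdom : Integrable (fun z : V3 => (16 * (1 + 2 * U ^ 2 + 2 * Θ) ^ 4 * (1 + (2 * Real.sqrt θm)⁻¹) * C *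
      (1 + ‖v‖ ^ 2) ^ 2 * (d + |θ - θ'| + ‖u - u'‖)) * (1 + ‖z‖ ^ 2) ^ 5) (stdGaussian V3) := hG.const_mul _
  have hpt : ∀ z : V3, ‖A (u' + Real.sqrt θ' • z) - A₀ (u + Real.sqrt θ • z)‖ ≤
      (16 * (1 + 2 * U ^ 2 + 2 * Θ) ^ 4 * (1 + (2 * Real.sqrt θm)⁻¹) * C *
        (1 + ‖v‖ ^ 2) ^ 2 * (d + |θ - θ'| + ‖u - u'‖)) * (1 + ‖z‖ ^ 2) ^ 5 := by
    intro z
    rw [Real.norm_eq_abs]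
    exact (k2r_bracket_coupled hθm hθ hθΘ hθ' hθ'Θ hu hu' ω hd hκ₁ hκ₁L hκ₁₂ v z).trans
      (le_of_eq (mul_right_comm _ _ _))
  have h := norm_integral_le_of_norm_le hdom (Eventually.of_forall hpt)
  rwa [Real.norm_eq_abs, integral_const_mul] at h

/-- **The corrector slice estimate.** For parameters `θ, θ′ ∈ [θm, Θ]`, `‖u‖, ‖u′‖ ≤ U` (`θm > 0`), a
direction `ω`, and continuous velocity functions `κ₁ = κ(x, ·)`, `κ₂ = κ(y, ·)` of quadratic growth `C`,
`κ₁` weighted-Lipschitz and `|κ₁ − κ₂| ≤ C (1 + 2|·|²) d`, the Maxwellian-weighted collision bracket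
`∫ M_{1,θ,u}(v) ∫ ((v−w)·ω)₊ M_{1,θ′,u′}(w) [κ₁(v′) + κ₂(w′) − κ₁(v) − κ₂(w)] dw dv` is
`≤ K C (d + |θ − θ′| + ‖u − u′‖)` in absolute value, `K = K(θm, Θ, U)`: it vanishes exactly at
`(θ′, u′, κ₂) = (θ, u, κ₁)` (`k2r_oneMaxwellian_bracket_rows_eq_zero`, local detailed balance), and the error
is controlled by `k2r_slice_inner`, integrated against `M_{1,θ,u}(v) dv` (uniform Gaussian moments).
[cite: CIP1994, §3.1] -/
theorem k2r_corrector_slice {θm : ℝ} (Θ U : ℝ) (hθm : 0 < θm) :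
    ∃ K : ℝ, 0 ≤ K ∧ ∀ (θ θ' : ℝ) (u u' : V3), θm ≤ θ → θ ≤ Θ → θm ≤ θ' → θ' ≤ Θ → ‖u‖ ≤ U → ‖u'‖ ≤ U →
      ∀ (ω : sphere (0 : V3) 1) (κ₁ κ₂ : V3 → ℝ), Continuous κ₁ → Continuous κ₂ →
      ∀ (C d : ℝ), 0 ≤ d → (∀ v, |κ₁ v| ≤ C * (1 + ‖v‖ ^ 2)) → (∀ v, |κ₂ v| ≤ C * (1 + ‖v‖ ^ 2)) →
      (∀ v v', |κ₁ v - κ₁ v'| ≤ C * (1 + ‖v‖ ^ 2 + ‖v'‖ ^ 2) * ‖v - v'‖) →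
      (∀ v, |κ₁ v - κ₂ v| ≤ C * (1 + ‖v‖ ^ 2 + ‖v‖ ^ 2) * d) →
      |∫ v, localMaxwellian 1 θ u v * ∫ w, max ⟪v - w, (ω : V3)⟫_ℝ 0 * localMaxwellian 1 θ' u' w *
          (κ₁ (v - ⟪v - w, (ω : V3)⟫_ℝ • (ω : V3)) + κ₂ (w + ⟪v - w, (ω : V3)⟫_ℝ • (ω : V3)) -
            κ₁ v - κ₂ w)| ≤ K * C * (d + |θ - θ'| + ‖u - u'‖) := by
  obtain ⟨CG, hCG0, hCG⟩ := exists_integral_one_add_norm_sq_sq_gaussMeasure_le U Θ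
  obtain ⟨G₅, hG₅⟩ : ∃ G : ℝ, G = ∫ z, (1 + ‖z‖ ^ 2) ^ 5 ∂stdGaussian V3 := ⟨_, rfl⟩
  have hG₅0 : 0 ≤ G₅ := by rw [hG₅]; exact integral_nonneg fun z => by positivity
  obtain ⟨K₁, hK₁⟩ : ∃ K : ℝ, K = 16 * (1 + 2 * U ^ 2 + 2 * Θ) ^ 4 * (1 + (2 * Real.sqrt θm)⁻¹) := ⟨_, rfl⟩
  have hK₁0 : 0 ≤ K₁ := by
    rw [hK₁]
    have : 0 ≤ (1 + 2 * U ^ 2 + 2 * Θ) ^ 4 := by positivity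
    positivity
  refine ⟨K₁ * G₅ * CG, by positivity, ?_⟩
  intro θ θ' u u' hθ hθΘ hθ' hθ'Θ hu hu' ω κ₁ κ₂ hκ₁c hκ₂c C d hd hκ₁ hκ₂ hκ₁L hκ₁₂
  have hθ0 : 0 < θ := hθm.trans_le hθ
  have hθ'0 : 0 < θ' := hθm.trans_le hθ'
  have hC : 0 ≤ C := by
    have h := (abs_nonneg _).trans (hκ₁ 0)
    simpa using h
  set δ : ℝ := d + |θ - θ'| + ‖u - u'‖ with hδ
  set M : V3 → ℝ := localMaxwellian 1 θ u with hM
  set M' : V3 → ℝ := localMaxwellian 1 θ' u'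
  -- the two-function bracket `A` and the one-function bracket `A₀`
  set A : V3 → V3 → ℝ := fun v w => hardSphereKernel (v, w) ω *
    (κ₁ (collide ω (v, w)).1 + κ₂ (collide ω (v, w)).2 - κ₁ v - κ₂ w) with hA
  set A₀ : V3 → V3 → ℝ := fun v w => hardSphereKernel (v, w) ω *
    (κ₁ (collide ω (v, w)).1 + κ₁ (collide ω (v, w)).2 - κ₁ v - κ₁ w)
  -- rewrite the goal in terms of `A`
  have hgoal : ∀ v, M v * ∫ w, max ⟪v - w, (ω : V3)⟫_ℝ 0 * M' w *
      (κ₁ (v - ⟪v - w, (ω : V3)⟫_ℝ • (ω : V3)) + κ₂ (w + ⟪v - w, (ω : V3)⟫_ℝ • (ω : V3)) - κ₁ v - κ₂ w) =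
      M v * ∫ w, M' w * A v w := by
    intro v
    congr 1
    refine integral_congr_ae (Eventually.of_forall fun w => ?_)
    simp only [hA, hardSphereKernel, collide]
    ring
  rw [integral_congr_ae (Eventually.of_forall hgoal)]
  -- integrable rows, the detailed-balance zero, and the inner coupling estimate
  have hBc : Continuous fun p : V3 × V3 => κ₁ (collide ω p).1 + κ₂ (collide ω p).2 - κ₁ p.1 - κ₂ p.2 := by
    fun_prop
  have hB₀c : Continuous fun p : V3 × V3 => κ₁ (collide ω p).1 + κ₁ (collide ω p).2 - κ₁ p.1 - κ₁ p.2 := by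
    fun_prop
  have hBb : ∀ {κ : V3 → ℝ}, (∀ v, |κ v| ≤ C * (1 + ‖v‖ ^ 2)) → ∀ p : V3 × V3,
      |κ₁ (collide ω p).1 + κ (collide ω p).2 - κ₁ p.1 - κ p.2| ≤ (4 * C) * ((1 + ‖p.1‖) * (1 + ‖p.2‖)) ^ 2 := by
    intro κ hκ p
    obtain ⟨hx1, -, hx3, -⟩ := quadGrowth_weights hκ₁ ω p
    obtain ⟨-, hy2, -, hy4⟩ := quadGrowth_weights hκ ω p
    have e1 := abs_sub (κ₁ (collide ω p).1 + κ (collide ω p).2 - κ₁ p.1) (κ p.2)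
    have e2 := abs_sub (κ₁ (collide ω p).1 + κ (collide ω p).2) (κ₁ p.1)
    have e3 := abs_add_le (κ₁ (collide ω p).1) (κ (collide ω p).2)
    linarith only [e1, e2, e3, hx1, hx3, hy2, hy4]
  have hI' : Integrable fun v : V3 => M v * ∫ w, M' w * A v w :=
    k2r_integrable_twoMaxwellian_row hθ0 hθ'0 u u' ω hBc (hBb hκ₂)
  have hI₀ : Integrable fun v : V3 => M v * ∫ w, M w * A₀ v w :=
    k2r_integrable_twoMaxwellian_row hθ0 hθ0 u u ω hB₀c (hBb hκ₁)
  have hE₀ : ∫ v, M v * ∫ w, M w * A₀ v w = 0 :=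
    k2r_oneMaxwellian_bracket_rows_eq_zero hθ0 u ω hκ₁c hκ₁
  have hinner : ∀ v : V3, |(∫ w, M' w * A v w) - ∫ w, M w * A₀ v w| ≤
      K₁ * C * (1 + ‖v‖ ^ 2) ^ 2 * δ * G₅ := by
    intro v
    have h := k2r_slice_inner hθm hθ hθΘ hθ' hθ'Θ hu hu' ω hκ₁c hκ₂c hd hκ₁ hκ₂ hκ₁L hκ₁₂ v
    rw [← hG₅, ← hδ, ← hK₁] at h
    exact h
  -- assembly
  have hdiff : ∫ v, M v * ∫ w, M' w * A v w =
      ∫ v, M v * ((∫ w, M' w * A v w) - ∫ w, M w * A₀ v w) := by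
    rw [← sub_zero (∫ v, M v * ∫ w, M' w * A v w), ← hE₀, ← integral_sub hI' hI₀]
    refine integral_congr_ae (Eventually.of_forall fun v => ?_)
    ring
  rw [hdiff]
  have hdom : Integrable fun v : V3 => M v * ((K₁ * C * δ * G₅) * (1 + ‖v‖ ^ 2) ^ 2) := by
    rw [hM, integrable_localMaxwellian_mul_iff hθ0]
    exact (integrable_one_add_norm_sq_pow_gaussMeasure u θ 2).const_mul _
  have hpt : ∀ v : V3, ‖M v * ((∫ w, M' w * A v w) - ∫ w, M w * A₀ v w)‖ ≤
      M v * ((K₁ * C * δ * G₅) * (1 + ‖v‖ ^ 2) ^ 2) := by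
    intro v
    have hMv : 0 ≤ M v := localMaxwellian_nonneg zero_le_one hθ0.le u v
    rw [Real.norm_eq_abs, abs_mul, abs_of_nonneg hMv]
    refine mul_le_mul_of_nonneg_left ((hinner v).trans (le_of_eq ?_)) hMv
    ring
  have h := norm_integral_le_of_norm_le hdom (Eventually.of_forall hpt)
  rw [Real.norm_eq_abs] at h
  refine h.trans ?_
  rw [hM, integral_localMaxwellian_mul_eq_integral_gaussMeasure hθ0, integral_const_mul]
  have hCGu := hCG u θ hu hθ0 hθΘ
  have h0 : 0 ≤ K₁ * C * δ * G₅ := by positivity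
  calc K₁ * C * δ * G₅ * ∫ v, (1 + ‖v‖ ^ 2) ^ 2 ∂gaussMeasure u θ
      ≤ K₁ * C * δ * G₅ * CG := mul_le_mul_of_nonneg_left hCGu h0
    _ = K₁ * G₅ * CG * C * δ := by ring

/-! ## Registered sub-goal of stub `stub_correctorBalance` proved in this file -/

/-- **Registered sub-goal `stub_correctorBalance_slice`** (K2R line `birth`, stub B4, helper III): the slice
estimate `k2r_corrector_slice`, as a closed statement. [cite: CIP1994, §3.1] -/
theorem stub_correctorBalance_slice :
    ∀ (θm Θ U : ℝ), 0 < θm → ∃ K : ℝ, 0 ≤ K ∧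
      ∀ (θ θ' : ℝ) (u u' : EuclideanSpace ℝ (Fin 3)), θm ≤ θ → θ ≤ Θ → θm ≤ θ' → θ' ≤ Θ → ‖u‖ ≤ U → ‖u'‖ ≤ U →
      ∀ (ω : Metric.sphere (0 : EuclideanSpace ℝ (Fin 3)) 1) (κ₁ κ₂ : EuclideanSpace ℝ (Fin 3) → ℝ),
      Continuous κ₁ → Continuous κ₂ →
      ∀ (C d : ℝ), 0 ≤ d → (∀ v, |κ₁ v| ≤ C * (1 + ‖v‖ ^ 2)) → (∀ v, |κ₂ v| ≤ C * (1 + ‖v‖ ^ 2)) →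
      (∀ v v', |κ₁ v - κ₁ v'| ≤ C * (1 + ‖v‖ ^ 2 + ‖v'‖ ^ 2) * ‖v - v'‖) →
      (∀ v, |κ₁ v - κ₂ v| ≤ C * (1 + ‖v‖ ^ 2 + ‖v‖ ^ 2) * d) →
      |∫ v : EuclideanSpace ℝ (Fin 3), Literature.Analysis.FluidPDE.localMaxwellian 1 θ u v *
          ∫ w : EuclideanSpace ℝ (Fin 3), max (inner ℝ (v - w) ω) 0 * Literature.Analysis.FluidPDE.localMaxwellian 1 θ' u' w *
          (κ₁ (v - inner ℝ (v - w) ω • (ω : EuclideanSpace ℝ (Fin 3))) +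
            κ₂ (w + inner ℝ (v - w) ω • (ω : EuclideanSpace ℝ (Fin 3))) - κ₁ v - κ₂ w)| ≤
        K * C * (d + |θ - θ'| + ‖u - u'‖) :=
  fun _ Θ U hθm => k2r_corrector_slice Θ U hθm

end Summit.AtomisticToContinuum.HydrodynamicLimit.Theorems.EnskogAdjointDuality

end
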